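import Summits.QuantumFields.QCD.Theorems.SpectralDefectExtinctionWindowExtinctionStubSpreadFromPartsR3Inlined

/-!
# Stub `stub_spreadFromPartsR3` (S6′, the end-game of reshape r3) of line `free-volume-heavy-witness`
(crux `Summit.QuantumFields.QCD.Theses.SpectralDefectExtinction.WindowExtinction`, item
stmt-QuantumFields-8964)

The statements `negCount`, `deepIndex`, `absIndexMean`, `FixedCouplingIndexSpreadSub`, `Tmpl`, `tmplHaar`,
`boxRestrict`, `MonotonePair`, `TemplatePair`, `NegCountMeasurable`, `ImplantCostBound`, `DetQuasilocal`,
`AntichainWeight`, `FiberAtomMonotone`, `ActiveCoresAbundant` are copied VERBATIM (bodies, names,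
namespace) from the lead's registered r3 skeleton `Cruxes/WindowExtinction/Lines/free_volume_heavy_witness_c2.lean`
(they live in no library module), so that the registered signature
`NegCountMeasurable → ImplantCostBound → DetQuasilocal → AntichainWeight → FiberAtomMonotone →
ActiveCoresAbundant → TemplatePair → ∀ Nf : ℕ, FixedCouplingIndexSpreadSub Nf` is stated literally.

Proof: this is `stub_spreadFromPartsR3_inlined` (sibling `…StubSpreadFromPartsR3Inlined.lean`, the same statement with
the def bodies unfolded, proved over the landed helpers `…SpreadR3Pi / Fiber / Decomp / Arith / Cores / Atom /
Window` and the previous lead's `…SpreadLayerCake / TorusBoxes / Telescope / Pattern`), by definitional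
unfolding of the defs below.
-/

noncomputable section

namespace Summit.QuantumFields.QCD.Cruxes.WindowExtinction.FreeVolumeHeavyWitness

open scoped BigOperators Topology Classical ENNReal
open Filter MeasureTheory Matrix
open Literature.MathematicalPhysics.QuantumLattice Literature.MathematicalPhysics.QuantumFieldTheory
  Literature.Probability.LatticeModels

/-! ## The statements (verbatim from the lead's skeleton `Lines/free_volume_heavy_witness_c2.lean`) -/

/-- The number of negative eigenvalues (with multiplicity, as roots of the characteristic polynomial) of
the Hermitian Wilson–Dirac operator `Γ₅ D_W(U, m₀, 1)` (`SU(3)`, fundamental, `r = 1`) on the four-torus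
of side `n`. -/
def negCount {n : ℕ} [NeZero n] (U : GaugeConfig 4 n SU3) (m₀ : ℝ) : ℕ :=
  (spinorLift gammaFive * wilsonDirac (fundamentalRep (Fin 3)) U m₀ 1).charpoly.roots.countP
    fun z : ℂ => z.re < 0

/-- The **deep index** `X_δ(U) = n₋(Γ₅ D_W(U, -δ, 1)) - 6 (2L'+1)⁴` on the odd torus of side `2L'+1`
(`6(2L'+1)⁴ = n/2`): the spectral index of the Hermitian Wilson–Dirac operator at bare mass `-δ`. -/
def deepIndex (L' : ℕ) (U : GaugeConfig 4 (2 * L' + 1) SU3) (δ : ℝ) : ℤ :=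
  (negCount U (-δ) : ℤ) - 6 * (2 * (L' : ℤ) + 1) ^ 4

/-- The phase-quenched mean `E₊^{β, 2L'+1, μ} |X_δ|` of the absolute deep index (weights
`∏_f |det D_W(U, μ_f, 1)|`, tree `qcdPhaseQuenchedExpect`). -/
def absIndexMean (Nf : ℕ) (β : ℝ) (L' : ℕ) (δ : ℝ) (μ : Fin Nf → ℝ) : ℝ :=
  qcdPhaseQuenchedExpect β (2 * L' + 1) μ fun U => |(deepIndex L' U δ : ℝ)|

/-- **C⁺_sub (fixed coupling, deep-subcritical).** `FixedCouplingIndexSpreadSub N_f`: for every aspect ratio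
`Q` of the depth/mass window there is an ABSOLUTE constant `h₀ = h₀(N_f, Q) > 0` such that at every inverse
coupling `β ≥ 0`, for every window `[lo, hi]` with `0 < lo ≤ hi ≤ Q·lo` that is DEEP-SUBCRITICAL,
`hi · max β 1 ≤ h₀` (depth `≤ h₀/β` at weak coupling — strictly below the partially-quenched critical depth
`|m_c(β)| ≈ 0.868/β` of the probe operator once `h₀ < 0.868`; drefute gen-1 §1b), and every `L₀`, some torus
half-side `L' ≥ L₀` has phase-quenched mean of `|X_δ|` at least `1` for all probes `δ ∈ [lo, hi]` and all
weight masses `μ ∈ [lo, hi]^{N_f}`.  No continuum limit, no scaling: infinite-volume statistics of lattice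
`SU(3)` at ONE cutoff; the reduction only ever uses the windows `[a_k/((K+1)Z_k), a_k(K+1)/Z_k]` (ratio `(K+1)²`,
top `≤ (K+1)/(k+1)`) at `β_k ≍ log k`, for which `hi_k β_k → 0`.  Without `0 < lo` or without the depth cap the
statement is FALSE (drefute gen-3, `DrefuteProbe3.lean`: `fixedCouplingIndexSpread_false_without_posLo/_depthCap`). -/
def FixedCouplingIndexSpreadSub (Nf : ℕ) : Prop :=
  ∀ Q : ℕ, ∃ h₀ : ℝ, 0 < h₀ ∧ ∀ β lo hi : ℝ, 0 ≤ β → 0 < lo → lo ≤ hi → hi ≤ Q * lo → hi * max β 1 ≤ h₀ →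
    ∀ L₀ : ℕ, ∃ L' : ℕ, L₀ ≤ L' ∧
      ∀ δ : ℝ, lo ≤ δ → δ ≤ hi → ∀ μ : Fin Nf → ℝ, (∀ f, lo ≤ μ f ∧ μ f ≤ hi) →
        1 ≤ absIndexMean Nf β L' δ μ

/-- A **template**: an assignment of forward links to the sites of the box `{-R,…,R}⁴ ⊂ ℤ⁴`. -/
abbrev Tmpl (R : ℕ) : Type := (↥(box 4 R) × Fin 4) → SU3

/-- Product Haar probability on templates. -/
def tmplHaar (R : ℕ) : Measure (Tmpl R) :=
  Measure.pi fun _ : ↥(box 4 R) × Fin 4 => haarProbability SU3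


section Vocabulary

variable {n : ℕ} [NeZero n]

/-- Restriction of a torus configuration to the box of radius `R` about (the image of) `c ∈ ℤ⁴`. -/
def boxRestrict (R : ℕ) (c : Fin 4 → ℤ) (U : GaugeConfig 4 n SU3) : Tmpl R :=
  fun yi => U (Torus.proj n (c + (yi.1 : Fin 4 → ℤ)), yi.2)


end Vocabulary

/-- **Monotone template pair at probe `δ`.**  Swapping the content of ONE box from any template of `Tm` to any
template of `Tp`, in ANY environment on ANY torus where the box embeds, raises `n₋(Γ₅ D_W(·, −δ, 1))` by at least
one.  (Supplied by S7 + S5b-m + S5b-p: `templatePair_of`.) -/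
def MonotonePair (R : ℕ) (Tp Tm : Set (Tmpl R)) (δ : ℝ) : Prop :=
  ∀ (n : ℕ) [NeZero n], 2 * R + 1 < n → ∀ (c : Fin 4 → ℤ) (U U' : GaugeConfig 4 n SU3),
    (∀ e, (¬ ∃ y : ↥(box 4 R), Torus.proj n (c + (y : Fin 4 → ℤ)) = e.1) → U' e = U e) →
    boxRestrict R c U ∈ Tm → boxRestrict R c U' ∈ Tp → negCount U (-δ) + 1 ≤ negCount U' (-δ)

/-- **Template pairs for every window** (the r3 replacement of C″'s template data): for every aspect ratio `Q`
and window `0 < lo ≤ hi ≤ Q·lo`, `hi ≤ 1/4`, a radius `R` and two Haar-positive measurable template classes that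
form a monotone pair at every probe of the window. -/
def TemplatePair : Prop :=
  ∀ (Q : ℕ) (lo hi : ℝ), 0 < lo → lo ≤ hi → hi ≤ Q * lo → hi ≤ 1 / 4 →
    ∃ (R : ℕ) (Tp Tm : Set (Tmpl R)), MeasurableSet Tp ∧ MeasurableSet Tm ∧
      tmplHaar R Tp ≠ 0 ∧ tmplHaar R Tm ≠ 0 ∧ ∀ δ : ℝ, lo ≤ δ → δ ≤ hi → MonotonePair R Tp Tm δ

/-- **S1 · measurability of the index.** `U ↦ n₋(Γ₅ D_W(U, m₀, 1))` (= `negCount U m₀`, inlined) is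
measurable on `SU(3)^{links}` (it is lower semicontinuous: negative eigenvalues of a continuously varying
Hermitian matrix stay negative; min–max `finrank_le_card_filter` + eigenvectors make `{n₋ ≥ j}` open).
Without it every `E₊` of a count in the crux is Bochner junk. -/
def NegCountMeasurable : Prop :=
  ∀ (n : ℕ) [NeZero n] (m₀ : ℝ), Measurable fun U : GaugeConfig 4 n SU3 =>
    (spinorLift gammaFive * wilsonDirac (fundamentalRep (Fin 3)) U m₀ 1).charpoly.roots.countP
      fun z : ℂ => z.re < 0

/-- **S2 · bounded local cost of a one-box surgery** (finite energy, phase-quenched; lead's reshape r1: stated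
for ANY two fields agreeing off the box image — tree vocabulary only, the implant form is the special case
`U = implant R t' c U₀`, `U' = implant R t c U₀`): changing the content of ONE box changes the Wilson action by at most `A` (only plaquettes touching the box move, each by `≤ 2·3`)
and the log of the phase-quenched weight by at most `B` (`D_W + μ` is coercive, `σ_min ≥ μ`, and the change
of `D_W` has rank `≤ r(R)` and norm `≤ 8`, so `|det(D'+μ)/det(D+μ)| ∈ [(1+8/μ)^{-r}, (1+8/μ)^{r}]`) —
uniformly in the volume, the position and the environment. -/
def ImplantCostBound : Prop :=
  ∀ (Nf R : ℕ) (lo hi : ℝ), 0 < lo → lo ≤ hi → ∃ A B : ℝ,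
    ∀ (n : ℕ) [NeZero n], 2 * R + 1 < n → ∀ (c : Fin 4 → ℤ) (μ : Fin Nf → ℝ),
      (∀ f, lo ≤ μ f ∧ μ f ≤ hi) → ∀ (U U' : GaugeConfig 4 n SU3),
        (∀ e, (¬ ∃ y : ↥(box 4 R), Torus.proj n (c + (y : Fin 4 → ℤ)) = e.1) → U' e = U e) →
        |wilsonAction (fundamentalRep (Fin 3)) U' - wilsonAction (fundamentalRep (Fin 3)) U| ≤ A ∧
          |Real.log (∏ f : Fin Nf, ‖fermionDet (wilsonDirac (fundamentalRep (Fin 3)) U' (μ f) 1)‖) -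
              Real.log (∏ f : Fin Nf, ‖fermionDet (wilsonDirac (fundamentalRep (Fin 3)) U (μ f) 1)‖)| ≤ B

/-- **S3 · quasi-locality of the fermionic weight** (Combes–Thomas; lead's reshape r1: stated for any four
fields `U, U₁, U₂, U₁₂` — `U₁`/`U₂` agree with `U` off box 1/box 2, `U₁₂` is `U₁` on box 1 and `U₂` off it —
tree vocabulary only; `TorusSeparated` inlined): the mixed second difference of
`log ∏_f |det(D_W + μ_f)|` under surgeries in two boxes at torus distance `≥ s` is `≤ C e^{-κ s}`
(`κ ≍ lo`, from the a-priori bound `‖(D_W + μ)⁻¹‖ ≤ 1/μ` and nearest-neighbour hopping), for EVERY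
environment and every pair of contents.  This is what lets the `|det|`-tilt be peeled off the Markov
(product) structure of the Wilson measure across separated cores. -/
def DetQuasilocal : Prop :=
  ∀ (Nf R : ℕ) (lo hi : ℝ), 0 < lo → lo ≤ hi → ∃ C κ : ℝ, 0 < κ ∧
    ∀ (n : ℕ) [NeZero n] (c₁ c₂ : Fin 4 → ℤ) (s : ℕ),
      (∀ q : Fin 4 → ℤ, ∃ j : Fin 4, ((2 * R + 1 + s : ℕ) : ℤ) ≤ |c₁ j - c₂ j - q j * n|) →
      ∀ (μ : Fin Nf → ℝ), (∀ f, lo ≤ μ f ∧ μ f ≤ hi) →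
        ∀ (U U₁ U₂ U₁₂ : GaugeConfig 4 n SU3),
          (∀ e, (¬ ∃ y : ↥(box 4 R), Torus.proj n (c₁ + (y : Fin 4 → ℤ)) = e.1) → U₁ e = U e) →
          (∀ e, (¬ ∃ y : ↥(box 4 R), Torus.proj n (c₂ + (y : Fin 4 → ℤ)) = e.1) → U₂ e = U e) →
          (∀ e, (∃ y : ↥(box 4 R), Torus.proj n (c₁ + (y : Fin 4 → ℤ)) = e.1) → U₁₂ e = U₁ e) →
          (∀ e, (¬ ∃ y : ↥(box 4 R), Torus.proj n (c₁ + (y : Fin 4 → ℤ)) = e.1) → U₁₂ e = U₂ e) →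
          |Real.log (∏ f : Fin Nf, ‖fermionDet (wilsonDirac (fundamentalRep (Fin 3)) U₁₂ (μ f) 1)‖) -
              Real.log (∏ f : Fin Nf, ‖fermionDet (wilsonDirac (fundamentalRep (Fin 3)) U₁ (μ f) 1)‖) -
              Real.log (∏ f : Fin Nf, ‖fermionDet (wilsonDirac (fundamentalRep (Fin 3)) U₂ (μ f) 1)‖) +
              Real.log (∏ f : Fin Nf, ‖fermionDet (wilsonDirac (fundamentalRep (Fin 3)) U (μ f) 1)‖)| ≤
            C * Real.exp (-(κ * s))

/-- **S4′ · anti-concentration of ANTICHAINS under non-degenerate product Bernoulli weights** (weighted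
Sperner / LYM): if every coordinate has odds in `[ε, 1−ε]`, the weight of any antichain of `{0,1}^N` (no two
distinct elements coordinatewise comparable) is `≤ C(ε)/√(N+1)`.  Proof route: split `Bern(p_i) =
2ε·Bern(1/2) + (1−2ε)·Bern(q_i)`, condition on the fair coordinates `J` and on the others; the section is an
antichain of `{0,1}^J`, so Sperner (`Finset.IsAntichain.sperner`) and the landed `stub_littlewoodOfford` at
`p ≡ 1/2` bound it by `C₀/√(|J|+1)`; finally `E[1/(Bin(N,2ε)+1)] ≤ 1/((N+1)·2ε)`.  Generalises S4
(`stub_littlewoodOfford`: level sets of `∑ ±1` are antichains).  Size M. -/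
def AntichainWeight : Prop :=
  ∀ ε : ℝ, 0 < ε → ∃ C : ℝ, ∀ (N : ℕ) (p : Fin N → ℝ), (∀ i, ε ≤ p i ∧ p i ≤ 1 - ε) →
    ∀ 𝒜 : Finset (Fin N → Bool), (∀ s ∈ 𝒜, ∀ s' ∈ 𝒜, (∀ i, s i ≤ s' i) → s = s') →
      ∑ s ∈ 𝒜, ∏ i, (if s i then p i else 1 - p i) ≤ C / Real.sqrt (N + 1)

/-- **S4″ · the fibre atom bound, MONOTONE form** (the twin of the landed `spread_fiber_atom_le_of_odds` with
exact increments replaced by STRICT MONOTONICITY in the `S'`-coordinates; everything else — the `e^{±τ}`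
mixture of a tilted product law, the odds form of non-degeneracy, the conclusion — is byte-identical).
Proof route: couple `t_i = t_i^{σ_i}` with independent representatives `t_i^p ~ e^{b_i}ν|Tp`, `t_i^m ~ e^{b_i}ν|Tm`
(normalised) and independent bits `σ_i ~ Bern(p_i)`, `p_i` = the tilted odds of `Tp` (in `[ε,1−ε]` by the odds
hypothesis); given the representatives, `σ ↦ X(t^σ)` is strictly increasing along single up-flips, so
`{σ | X(t^σ) = j}` is an antichain and S4′ applies; integrating the representatives out returns
`∏_i ∫_{Tp∪Tm} e^{b_i} dν`.  Size L. -/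
def FiberAtomMonotone : Prop :=
  ∀ {I T : Type} [Fintype I] [DecidableEq I] [MeasurableSpace T]
    (ν : Measure T) [IsProbabilityMeasure ν] {Tp Tm : Set T},
    MeasurableSet Tp → MeasurableSet Tm → Disjoint Tp Tm → ν Tp ≠ 0 →
    ∀ {ε C : ℝ},
    (∀ (N : ℕ) (p : Fin N → ℝ), (∀ i, ε ≤ p i ∧ p i ≤ 1 - ε) →
      ∀ 𝒜 : Finset (Fin N → Bool), (∀ s ∈ 𝒜, ∀ s' ∈ 𝒜, (∀ i, s i ≤ s' i) → s = s') →
        ∑ s ∈ 𝒜, ∏ i, (if s i then p i else 1 - p i) ≤ C / Real.sqrt (N + 1)) →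
    ∀ {φ : (I → T) → ℝ}, Measurable φ → ∀ {a τ B : ℝ} {b : I → T → ℝ},
    (∀ i, Measurable (b i)) →
    (∀ t : I → T, (∀ i, t i ∈ Tp ∪ Tm) → |φ t - a - ∑ i, b i (t i)| ≤ τ) →
    (∀ i u u', u ∈ Tp ∪ Tm → u' ∈ Tp ∪ Tm → b i u ≤ b i u' + B) →
    (∀ i, ε * ∫ u in Tp ∪ Tm, Real.exp (b i u) ∂ν ≤ ∫ u in Tp, Real.exp (b i u) ∂ν ∧
      ∫ u in Tp, Real.exp (b i u) ∂ν ≤ (1 - ε) * ∫ u in Tp ∪ Tm, Real.exp (b i u) ∂ν) →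
    ∀ {X : (I → T) → ℤ}, Measurable X → ∀ (S' : Finset I),
    (∀ t : I → T, (∀ i, t i ∈ Tp ∪ Tm) → ∀ i ∈ S', ∀ u ∈ Tp, t i ∈ Tm →
      X t + 1 ≤ X (Function.update t i u)) →
    ∀ (j : ℤ),
    ∫⁻ t, (Set.pi Set.univ fun _ : I => Tp ∪ Tm).indicator
        (fun t => if X t = j then ENNReal.ofReal (Real.exp (φ t)) else 0) t
        ∂Measure.pi (fun _ : I => ν) ≤
      ENNReal.ofReal (Real.exp (2 * τ) * C / Real.sqrt (S'.card + 1)) *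
        ∫⁻ t, (Set.pi Set.univ fun _ : I => Tp ∪ Tm).indicator
          (fun t => ENNReal.ofReal (Real.exp (φ t))) t ∂Measure.pi (fun _ : I => ν)

/-- **S5a · many boxes are active** (sequential conditioning; the only probabilistic input about the sea).
On the torus of side `n` take `N` pairwise `(2R+2)`-separated boxes (disjoint images), positive masses, a
measurable template class `T` of Haar measure `≥ q > 0`, and suppose the phase-quenched density
`ρ = e^{−βS_W} ∏_f |det D_W(·, μ_f, 1)|` changes by at most the factor `Λ ≥ 1` under ANY change of the content of
ANY one of the boxes (landed S2 `stub_implantCost`: `Λ = e^{βA+B}`).  Then the conditional probability that a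
box is active (content in `T`) given everything else is `≥ p := q/Λ²`, so for every set of `|S|` boxes
`P(all inactive) ≤ (1−p)^{|S|}` by induction (resampling one box = integrating its links against product Haar),
and by a union bound over the `C(N, N−m+1)` sets of `N−m+1` boxes,
`P(fewer than m boxes active) ≤ C(N, N−(m−1))·(1−p)^{N−(m−1)}` (`= 1` when `m − 1 > N`).  Size M–L. -/
def ActiveCoresAbundant : Prop :=
  ∀ (Nf n R N m : ℕ) [NeZero n], 2 * R + 1 < n → ∀ (cs : Fin N → (Fin 4 → ℤ)),
    (∀ i j, i ≠ j → ∀ q : Fin 4 → ℤ, ∃ k : Fin 4, ((2 * R + 2 : ℕ) : ℤ) ≤ |cs i k - cs j k - q k * n|) →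
    ∀ (β : ℝ) (μ : Fin Nf → ℝ), (∀ f, 0 < μ f) →
    ∀ (T : Set ((↥(box 4 R) × Fin 4) → SU3)), MeasurableSet T →
    ∀ (Λ q : ℝ), 1 ≤ Λ → 0 < q →
      q ≤ ((Measure.pi fun _ : ↥(box 4 R) × Fin 4 => haarProbability SU3) T).toReal →
      (∀ (i : Fin N) (U U' : GaugeConfig 4 n SU3),
        (∀ e, (¬ ∃ y : ↥(box 4 R), Torus.proj n (cs i + (y : Fin 4 → ℤ)) = e.1) → U' e = U e) →
        Real.exp (-β * wilsonAction (fundamentalRep (Fin 3)) U') *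
            ∏ f, ‖fermionDet (wilsonDirac (fundamentalRep (Fin 3)) U' (μ f) 1)‖ ≤
          Λ * (Real.exp (-β * wilsonAction (fundamentalRep (Fin 3)) U) *
            ∏ f, ‖fermionDet (wilsonDirac (fundamentalRep (Fin 3)) U (μ f) 1)‖)) →
      qcdLatticeMeasure n β μ
          {U | (Finset.univ.filter fun i : Fin N =>
              (fun yi : ↥(box 4 R) × Fin 4 => U (Torus.proj n (cs i + (yi.1 : Fin 4 → ℤ)), yi.2)) ∈ T).card
            < m} ≤
        ENNReal.ofReal ((N.choose (N - (m - 1)) : ℝ) * (1 - q / Λ ^ 2) ^ (N - (m - 1)))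

/-! ## The stub -/

/-- **STUB S6′** (= `SpreadFromPartsR3`): the landed S1–S3, S4″ (with S4′), S5a and the template pairs give
the deep-subcritical fixed-coupling spread `C⁺_sub` for every `N_f` (with `h₀ = 1/4`).  Definitionally the
landed `stub_spreadFromPartsR3_inlined`. -/
theorem stub_spreadFromPartsR3 :
    NegCountMeasurable → ImplantCostBound → DetQuasilocal → AntichainWeight → FiberAtomMonotone →
      ActiveCoresAbundant → TemplatePair → ∀ Nf : ℕ, FixedCouplingIndexSpreadSub Nf :=
  fun h₁ h₂ h₃ h₄ h₅ h₆ h₇ => stub_spreadFromPartsR3_inlined h₁ h₂ h₃ h₄ h₅ h₆ h₇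

end Summit.QuantumFields.QCD.Cruxes.WindowExtinction.FreeVolumeHeavyWitness

end
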